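import Summits.PneNP.PneNP.Theorems.ReslinSizeFromWidthQuadraticReach

/-!
# PneNP / ReslinSizeFromWidth — quadratic size–width law, part 3a: the bound `B`, axiom
hypotheses, pruning

Helper file for the quadratic truncation of crux `ResLinSizeFromWidth` (stmt-PneNP-18932).
`B t K = 1 + Σ_{s=t+1}^{K} s` (recursion, monotonicity, closed form); the standing hypotheses on
the axiom flats (`GoodAxioms`: flats, of rank `≤ t` relative to the ambient flat) and their
inheritance by hyperplane sections; PRUNING a refutation to its lines reachable from the root
(still a refutation, every line now ending a premise chain).
-/

namespace Summit.PneNP.PneNP.Theorems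

-- `Summit.PneNP.PneNP` repeats a path component by design (summit = sub-problem); silence the linter.
set_option linter.dupNamespace false

namespace ResLinSW

section Induction

open Module Submodule
open scoped Pointwise

variable {V : Type*} [Fintype V]

/-! ### The size function `B t K = 1 + Σ_{s = t+1}^{K} s` -/

/-- `B t K = 1 + Σ_{s=t+1}^{K} s`, defined by recursion on `K`. -/
def B (t : ℕ) : ℕ → ℕ
  | 0 => 1
  | K + 1 => if t < K + 1 then B t K + (K + 1) else 1

/-- Below the axiom rank the bound is trivial: `B t K = 1` for `K ≤ t`. -/
theorem B_of_le {t K : ℕ} (h : K ≤ t) : B t K = 1 := by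
  cases K with
  | zero => rfl
  | succ K => simp [B, Nat.not_lt.2 h]

/-- The recursion step: `B t K = B t (K-1) + K` for `t < K`. -/
theorem B_of_lt {t K : ℕ} (h : t < K) : B t K = B t (K - 1) + K := by
  cases K with
  | zero => exact absurd h (Nat.not_lt_zero t)
  | succ K => simp [B, h]

/-- `1 ≤ B t K`. -/
theorem one_le_B (t K : ℕ) : 1 ≤ B t K := by
  cases K with
  | zero => exact le_rfl
  | succ K =>
    simp only [B]
    split_ifs <;> omega

/-- `B t` is monotone. -/
theorem B_mono (t : ℕ) : Monotone (B t) := by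
  refine monotone_nat_of_le_succ fun K => ?_
  show B t K ≤ B t (K + 1)
  simp only [B]
  split_ifs with h
  · omega
  · rw [B_of_le (by omega)]

/-- Closed form: `2 · B t K = 2 + K(K+1) - t(t+1)` for `t ≤ K`. -/
theorem two_mul_B {t : ℕ} : ∀ {K : ℕ}, t ≤ K → 2 * B t K + t * (t + 1) = 2 + K * (K + 1)
  | 0, h => by
    have : t = 0 := Nat.le_zero.1 h
    subst this
    simp [B]
  | K + 1, h => by
    by_cases hK : t ≤ K
    · have ih := two_mul_B hK
      rw [B_of_lt (by omega), Nat.add_sub_cancel]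
      nlinarith [ih]
    · have : t = K + 1 := by omega
      subst this
      rw [B_of_le le_rfl]

/-! ### Standing hypotheses on the axiom flats, and their inheritance by sections -/

/-- The axiom flats are flats, and those meeting `A` have rank `≤ t` relative to `A`. -/
structure GoodAxioms (𝒞 : Set (Set (V → ZMod 2))) (A : Set (V → ZMod 2)) (t : ℕ) : Prop where
  /-- axiom flats are flats -/
  flat : ∀ F ∈ 𝒞, IsFlat F
  /-- axiom flats meeting `A` have relative rank at most `t` -/
  rank : ∀ F ∈ 𝒞, (F ∩ A).Nonempty → codim A (F ∩ A) ≤ t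

/-- A proper nonempty hyperplane section of a flat `A` raises `dim W` by one (restated). -/
theorem finrank_W_section {A : Set (V → ZMod 2)} (hA : IsFlat A) {θ : Eqn V}
    (h0 : (A ∩ hyp θ).Nonempty) (h1 : (A ∩ hyp (θ + one)).Nonempty) :
    finrank (ZMod 2) ↥(W (A ∩ hyp θ)) = finrank (ZMod 2) ↥(W A) + 1 := by
  refine finrank_W_inter_hyp_eq hA θ h0 fun hθ => ?_
  obtain ⟨a, haA, ha⟩ := h1
  exact (mem_hyp_add_one_iff.1 ha) (hθ a haA)

omit [Fintype V] in
/-- `θ + one + one = θ`. -/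
theorem add_one_add_one (θ : Eqn V) : θ + one + one = θ := by
  rw [add_assoc]
  have : (one : Eqn V) + one = 0 :=
    Prod.ext (by simp [one]) (by show (1 : ZMod 2) + 1 = 0; decide)
  rw [this, add_zero]

/-- The standing hypotheses pass to a proper hyperplane section. -/
theorem GoodAxioms.section {𝒞 : Set (Set (V → ZMod 2))} {A : Set (V → ZMod 2)} {t : ℕ}
    (hg : GoodAxioms 𝒞 A t) (hA : IsFlat A) {θ : Eqn V} (h0 : (A ∩ hyp θ).Nonempty)
    (h1 : (A ∩ hyp (θ + one)).Nonempty) : GoodAxioms 𝒞 (A ∩ hyp θ) t := by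
  refine ⟨hg.flat, fun F hF hne => ?_⟩
  have hFA : IsFlat (F ∩ A) := (hg.flat F hF).inter hA
  have hne' : (F ∩ A).Nonempty := hne.mono (Set.inter_subset_inter_right _ Set.inter_subset_left)
  have hr := hg.rank F hF hne'
  have heq : F ∩ (A ∩ hyp θ) = (F ∩ A) ∩ hyp θ := (Set.inter_assoc _ _ _).symm
  have hle := finrank_W_inter_hyp_le hFA θ (by rw [← heq]; exact hne)
  have hsec := finrank_W_section hA h0 h1
  have hmono : finrank (ZMod 2) ↥(W A) ≤ finrank (ZMod 2) ↥(W (F ∩ A)) :=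
    Submodule.finrank_mono (W_anti Set.inter_subset_right)
  unfold codim at hr ⊢
  rw [heq, hsec]
  omega

/-! ### Pruning to the reachable lines -/

open Classical in
/-- The Boolean test "reachable from `A` in `L`". -/
noncomputable def reachB (L : List (Set (V → ZMod 2))) (A N : Set (V → ZMod 2)) : Bool :=
  decide (Reach L A N)

/-- `reachB L A N = true ↔ Reach L A N`. -/
theorem reachB_iff (L : List (Set (V → ZMod 2))) (A N : Set (V → ZMod 2)) :
    reachB L A N = true ↔ Reach L A N := by
  simp [reachB]

omit [Fintype V] in
/-- The last-occurrence tail lies inside the tail of any occurrence. -/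
theorem ltail_suffix_of_cons_suffix {N : Set (V → ZMod 2)} {T : List (Set (V → ZMod 2))} :
    ∀ {L : List (Set (V → ZMod 2))}, N :: T <:+ L → ltail N L <:+ T
  | [], h => by
    obtain ⟨t, ht⟩ := h
    simp at ht
  | M :: L, h => by
    classical
    rcases List.suffix_cons_iff.1 h with h | h
    · have hNM : N = M := (List.cons.inj h).1
      have hTL : T = L := (List.cons.inj h).2
      subst hNM
      rw [hTL]
      simp only [ltail]
      split_ifs with hNL
      · exact (List.suffix_cons _ _).trans (cons_ltail_suffix hNL)
      · exact List.suffix_refl _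
    · have hNL : N ∈ L := h.subset List.mem_cons_self
      simp only [ltail, if_pos hNL]
      exact ltail_suffix_of_cons_suffix h

/-- **Pruning.** A refutation inside a nonempty `A` contains a refutation all of whose lines are
reachable from the root along premise steps. -/
theorem prune {𝒞 : Set (Set (V → ZMod 2))} {A : Set (V → ZMod 2)} {L : List (Set (V → ZMod 2))}
    (hL : IsRef 𝒞 A L) (hA : A.Nonempty) :
    IsRef 𝒞 A (L.filter (reachB L A)) ∧ ∀ N ∈ L.filter (reachB L A), Reach L A N := by
  classical
  refine ⟨⟨?_, ?_, ?_, ?_⟩, ?_⟩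
  · refine hL.deriv.filter (reachB L A) fun N T hs hN => ?_
    have hreach : Reach L A N := (reachB_iff L A N).1 hN
    have hNne : N.Nonempty := hreach.nonempty hA
    have hNL : N ∈ L := hs.subset List.mem_cons_self
    have hNflat : IsFlat N := hL.flat N hNL
    have hlt : ltail N L <:+ T := ltail_suffix_of_cons_suffix hs
    have hj := hL.deriv.justified_ltail hNL
    -- a premise reached by a step is kept
    have keep : ∀ P, P ∈ ltail N L → P.Nonempty → (∃ e : Eqn V, W P ≤ W N ⊔ (ZMod 2) ∙ e) →
        P ∈ T.filter (reachB L A) := by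
      intro P hP hPne hle
      rw [List.mem_filter]
      exact ⟨hlt.subset hP, (reachB_iff L A P).2 (Reach.step hreach ⟨hP, hPne, hle⟩)⟩
    cases hj with
    | ax F hF h => exact Justified.ax F hF h
    | split η P Q hP hQ h0 h1 =>
      by_cases h0ne : (N ∩ hyp η).Nonempty
      · have hPkeep : P ∈ T.filter (reachB L A) := by
          refine keep P hP (h0ne.mono h0) ⟨η, ?_⟩
          rw [← W_inter_hyp hNflat η h0ne]
          exact W_anti h0
        by_cases h1ne : (N ∩ hyp (η + one)).Nonempty
        · have hQkeep : Q ∈ T.filter (reachB L A) := by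
            refine keep Q hQ (h1ne.mono h1) ⟨η + one, ?_⟩
            rw [← W_inter_hyp hNflat (η + one) h1ne]
            exact W_anti h1
          exact Justified.split η P Q hPkeep hQkeep h0 h1
        · -- the θ+1 half is empty: N ⊆ hyp η, so N ⊆ P
          rw [Set.not_nonempty_iff_eq_empty] at h1ne
          have hNP : N ⊆ P := by
            intro z hz
            by_cases hzη : z ∈ hyp η
            · exact h0 ⟨hz, hzη⟩
            · have : z ∈ N ∩ hyp (η + one) := ⟨hz, mem_hyp_add_one_iff.2 hzη⟩
              rw [h1ne] at this
              exact absurd this (Set.notMem_empty z)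
          exact Justified.weaken hPkeep hNP
      · -- the θ half is empty: N ⊆ Q
        rw [Set.not_nonempty_iff_eq_empty] at h0ne
        have hNQ : N ⊆ Q := by
          intro z hz
          by_cases hzη : z ∈ hyp η
          · have : z ∈ N ∩ hyp η := ⟨hz, hzη⟩
            rw [h0ne] at this
            exact absurd this (Set.notMem_empty z)
          · exact h1 ⟨hz, mem_hyp_add_one_iff.2 hzη⟩
        have hQkeep : Q ∈ T.filter (reachB L A) :=
          keep Q hQ (hNne.mono hNQ) ⟨0, by simpa using W_anti hNQ⟩
        exact Justified.weaken hQkeep hNQ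
  · exact List.mem_filter.2 ⟨hL.root, (reachB_iff L A A).2 Reach.root⟩
  · intro N hN
    exact hL.subset N (List.mem_filter.1 hN).1
  · intro N hN
    exact hL.flat N (List.mem_filter.1 hN).1
  · intro N hN
    exact (reachB_iff L A N).1 (List.mem_filter.1 hN).2

end Induction

end ResLinSW

end Summit.PneNP.PneNP.Theorems
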